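/-
Origin: expansion seat `prover-pub-hodgecm-mc-binder-2-g10-0`, handover #28 23:55Z md5 ec3251eb2280 (211 l.; imports #27 + #4 `InsRaw` (RUN 36) + PKG `PerL34.PrintedTorusMatch`; the GLOBAL census data from a family `datum : ∀ b, PlaceDatum … (cmPlacesEquiv L b)`: abbrevs `kindOf`/`lamOf`/`embOf`, `lamOf_ne_zero`, **`ins datum m₁ m₂ f := insRaw L⁺ cmBigFrame (cmPlacesEquiv L) embOf f : 𝓕_print →ₗ[ℂ] 𝒮(𝔸^{Fin 6})`** (`FinIdx := FinSB L⁺ (Fin 6)`), `placePoly`, `rest`, `ins_tprod`, `placePoly_apply`, `rest_update`, **`ins_tprod_eq_block b`** (`ins f (⊗ₜ m) = E(F_v⁻¹(binvPi (rename (cmIdx v) (emb_b (m b))) ⊠ rest_v m) ⊗ f)`, v = cmPlacesEquiv L b), `hypOpWGen_binvPi_embOf`, `hypX_tprod`, **`ins_hypX_tprod_eq_block`** (`ins f (H^{(b)} ⊗ₜ m) = E(F_v⁻¹((hypOpWGen (binvPi …)) ⊠ rest_v m) ⊗ f)`); NAME LIST `HodgeCM.Model.HypCensus.ins_tprod_eq_block`,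 `HodgeCM.Model.HypCensus.ins_hypX_tprod_eq_block`, `HodgeCM.Model.HypCensus.rest_update`) (`HOME/mc/pub-hodgecm-mc-binder-2/g10/pkg/HodgeCM/Model/HypCensus/Ins.lean`, md5 ec3251eb2280, 211 lines);
landed by the second packager (p2) in gate run 38 as `HodgeCM/Model/HypCensus/Ins.lean` (verbatim).
-/
/-
Origin: speedrun cell pub-hodgecm, MODEL-CONSTRUCTION sub-cell, lineage mc-binder-2 (BINDER-OWNERS rows 18/19: E binders
`hyp12` / `hyp34` of `Model.perL_picardCM_r15A`), seat prover-pub-hodgecm-mc-binder-2-g10-0 (gen 10), 2026-08-19.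
Target in PKG: `HodgeCM/Model/HypCensus/Ins.lean` (NEW additive leaf; imports this lineage's `HypCensus/PlaceDatum` (#27a), the
RUN-36 INSTALLED `HypCensus/InsRaw` (#4), and pv11 `PerL34/PrintedTorusMatch` (RUN 31)).
KERNEL ONLY: 0 records, nothing cited, 0 `def … : Prop`; definitions + `rfl`/`simp`-grade lemmas.
-/
import Summits.HodgeConjecture.HodgeCM.Model.HypCensus.PlaceDatum_2
import Summits.HodgeConjecture.HodgeCM.Model.HypCensus.InsRaw
import Summits.HodgeConjecture.HodgeCM.PerL34.PrintedTorusMatch_2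

/-!
# Census kit (rows A12/A34): the printed insertion `ins` of the W-instance — places, kinds, per-place embeddings

The census record `HypSideW W₀ jT kind lam hlam m₁ m₂` (`HypCensus/SideW`, #22) wants, per good sextic context, a kind map
`kind : InfinitePlace L → PlaceKind`, Adams parameters `lam`, and the printed insertion
`ins : FinIdx → 𝓕_print →ₗ[ℂ] 𝒮(𝔸_{L⁺}^{Fin 6})`, `𝓕_print = ⨂_b 𝓕^{κ_b}_b` the tensor product over the infinite places `b` of
the CM field `L` of pv12's printed local κ-parts (`ℂ[P] ⊂ ℂ[z_a, w_a]` at `Σ₁₂`, `ℂ·1 ⊂ ℂ[M₃ₓ₂]` at `D₁₂`, `ℂ·det z ⊂ ℂ[z_{aj}, w_j]`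
at `ι₁`).  This leaf assembles the GLOBAL data from a family of place data and proves the two bookkeeping lemmas every field proof starts from.

* the per-place DATA (`cmPlacesEquiv`, `KindVar`/`kindIncl`, the structure `PlaceDatum v` with its constructors and LEMMA A) is the
  sibling leaf `HypCensus/PlaceDatum`;
* §5 the GLOBAL data from a family `datum : ∀ b, PlaceDatum … (cmPlacesEquiv L b)`: `kindOf`, `lamOf`, `lamOf_ne_zero`, `embOf`,
  **`ins datum m₁ m₂ f : 𝓕_print →ₗ[ℂ] 𝒮(𝔸^{Fin 6})`** (`:= insRaw L⁺ cmBigFrame (cmPlacesEquiv L) (embOf …) f`, `FinIdx := FinSB L⁺ (Fin 6)`),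
  `ins_tprod`, `hypX_tprod`, and **`ins_tprod_eq_block b`**: at every place `b` the inserted pure tensor IS
  `E(F_v⁻¹(binvPi (rename (cmIdx v) ((datum b).emb (m b))) ⊠ Φ_rest) ⊗ f)`, `v = cmPlacesEquiv L b` — the shape consumed by
  `SmoothW` / `TorusBlock` / `KappaEigen`; `rest_update` (the other factor ignores the `b`-slot).

Nothing here is a claim of PerL/QW8.  Style lint (L-notation): no `local notation`.
-/

set_option autoImplicit false

noncomputable section

open scoped TensorProduct Classical
open MvPolynomial NumberField NumberField.InfinitePlace Complex
open Literature.Analysis.SegalBargmann Literature.NumberTheory.Weil1964 Literature.NumberTheory.Automorphic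
open Literature.RepresentationTheory (atPlace)
open Literature.RepresentationTheory.KonnoKonno2007 Literature.RepresentationTheory.KonnoKonno2007.RealDualPair
open HodgeCM.PerL34.Fock HodgeCM.PerL34.Fock.PrintDict

namespace HodgeCM.Model.HypCensus

/-! ## §5 The global data of the census from a family of place data -/

section Global

variable (L : Type) [Field L] [NumberField L] [IsCMField L]
variable (dV : Fin 3 → L) (hdV : ∀ i, IsCMField.complexConj L (dV i) = dV i) (hdV0 : ∀ i, dV i ≠ 0)
variable (dW : Fin 2 → L) (hdW : ∀ i, IsCMField.complexConj L (dW i) = dW i) (hdW0 : ∀ i, dW i ≠ 0)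
variable (ι₁ : L →+* ℂ)
variable (datum : ∀ b : InfinitePlace L, PlaceDatum L dV hdV dW hdW ι₁ (cmPlacesEquiv L b))

/-- the kind map of the census. -/
abbrev kindOf (b : InfinitePlace L) : PlaceKind := (datum b).kind

/-- Adams's parameters of the census. -/
abbrev lamOf (b : InfinitePlace L) : ℂ := (datum b).lam

/-- (Ported verbatim from the HodgeCMPerL package; no docstring in the source.) -/
theorem lamOf_ne_zero : ∀ b : InfinitePlace L, lamOf L dV hdV dW hdW ι₁ datum b ≠ 0 := fun b => (datum b).lam_ne_zero

variable (m₁ m₂ : InfinitePlace L → ℤ)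

/-- the per-place embeddings of the census (pinned vacuum characters). -/
abbrev embOf (b : InfinitePlace L) :
    ((printPlaces (InfinitePlace L) (kindOf L dV hdV dW hdW ι₁ datum) (lamOf L dV hdV dW hdW ι₁ datum)
        (lamOf_ne_zero L dV hdV dW hdW ι₁ datum) (pinnedVacs (kindOf L dV hdV dW hdW ι₁ datum) m₁ m₂)).loc b).M →ₗ[ℂ]
      MvPolynomial (Fin 6) ℂ :=
  (datum b).emb (pinnedVacs (kindOf L dV hdV dW hdW ι₁ datum) m₁ m₂ b)

/-- **the printed insertion of the census** `(f, φ) ↦ E(follandFock cmBigFrame (∏_b emb_b φ_b) ⊗ f)`, linear in `φ`, finite index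
`FinIdx := FinSB L⁺ (Fin 6)` (kit #4 `insRaw` at the frame of record `cmBigFrame` and the place identification `cmPlacesEquiv`). -/
def ins (f : FinSB ↥(maximalRealSubfield L) (Fin 6)) :
    (printPlaces (InfinitePlace L) (kindOf L dV hdV dW hdW ι₁ datum) (lamOf L dV hdV dW hdW ι₁ datum)
        (lamOf_ne_zero L dV hdV dW hdW ι₁ datum) (pinnedVacs (kindOf L dV hdV dW hdW ι₁ datum) m₁ m₂)).F →ₗ[ℂ]
      ↥(piSchwartzBruhat ↥(maximalRealSubfield L) (Fin 6)) :=
  insRaw ↥(maximalRealSubfield L) (cmBigFrame L finProdFinEquiv dV hdV hdV0 dW hdW hdW0 ι₁) (cmPlacesEquiv L)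
    (embOf L dV hdV dW hdW ι₁ datum m₁ m₂) f

/-- the archimedean place polynomials of a pure tensor, indexed by the real places of `L⁺`. -/
def placePoly
    (m : ∀ b : InfinitePlace L, ((printPlaces (InfinitePlace L) (kindOf L dV hdV dW hdW ι₁ datum)
      (lamOf L dV hdV dW hdW ι₁ datum) (lamOf_ne_zero L dV hdV dW hdW ι₁ datum)
      (pinnedVacs (kindOf L dV hdV dW hdW ι₁ datum) m₁ m₂)).loc b).M)
    (w : {w : InfinitePlace ↥(maximalRealSubfield L) // w.IsReal}) : MvPolynomial (Fin 6) ℂ :=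
  embOf L dV hdV dW hdW ι₁ datum m₁ m₂ ((cmPlacesEquiv L).symm w) (m ((cmPlacesEquiv L).symm w))

/-- the "other places" factor at `v`: the Bargmann inverse of the product of the place polynomials off `v`. -/
def rest (v : {w : InfinitePlace ↥(maximalRealSubfield L) // w.IsReal})
    (m : ∀ b : InfinitePlace L, ((printPlaces (InfinitePlace L) (kindOf L dV hdV dW hdW ι₁ datum)
      (lamOf L dV hdV dW hdW ι₁ datum) (lamOf_ne_zero L dV hdV dW hdW ι₁ datum)
      (pinnedVacs (kindOf L dV hdV dW hdW ι₁ datum) m₁ m₂)).loc b).M) :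
    SchwartzMap (Fin 6 × {w : {w : InfinitePlace ↥(maximalRealSubfield L) // w.IsReal} // w ≠ v} → ℝ) ℂ :=
  binvPi (∏ w' : {w : {w : InfinitePlace ↥(maximalRealSubfield L) // w.IsReal} // w ≠ v},
    rename (atPlace w') (placePoly L dV hdV dW hdW ι₁ datum m₁ m₂ m w'.1))

/-- value of `ins` on pure tensors (kit #4 `insRaw_tprod`). -/
theorem ins_tprod (f : FinSB ↥(maximalRealSubfield L) (Fin 6))
    (m : ∀ b : InfinitePlace L, ((printPlaces (InfinitePlace L) (kindOf L dV hdV dW hdW ι₁ datum)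
      (lamOf L dV hdV dW hdW ι₁ datum) (lamOf_ne_zero L dV hdV dW hdW ι₁ datum)
      (pinnedVacs (kindOf L dV hdV dW hdW ι₁ datum) m₁ m₂)).loc b).M) :
    ins L dV hdV hdV0 dW hdW hdW0 ι₁ datum m₁ m₂ f (PiTensorProduct.tprod ℂ m) =
      piSchwartzBruhatEquiv ↥(maximalRealSubfield L) (Fin 6)
        (follandFock (cmBigFrame L finProdFinEquiv dV hdV hdV0 dW hdW hdW0 ι₁)
          (∏ w, rename (atPlace w) (placePoly L dV hdV dW hdW ι₁ datum m₁ m₂ m w)) ⊗ₜ f) :=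
  insRaw_tprod _ _ _ _ _ m

/-- the place polynomial at the place of `b` is `emb_b (m b)`. -/
theorem placePoly_apply (b : InfinitePlace L)
    (m : ∀ b : InfinitePlace L, ((printPlaces (InfinitePlace L) (kindOf L dV hdV dW hdW ι₁ datum)
      (lamOf L dV hdV dW hdW ι₁ datum) (lamOf_ne_zero L dV hdV dW hdW ι₁ datum)
      (pinnedVacs (kindOf L dV hdV dW hdW ι₁ datum) m₁ m₂)).loc b).M) :
    placePoly L dV hdV dW hdW ι₁ datum m₁ m₂ m (cmPlacesEquiv L b) = embOf L dV hdV dW hdW ι₁ datum m₁ m₂ b (m b) := by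
  unfold placePoly
  have key : ∀ b' : InfinitePlace L, b' = b →
      embOf L dV hdV dW hdW ι₁ datum m₁ m₂ b' (m b') = embOf L dV hdV dW hdW ι₁ datum m₁ m₂ b (m b) := by
    rintro _ rfl; rfl
  exact key _ ((cmPlacesEquiv L).symm_apply_apply b)

/-- **the other factor ignores the `b`-slot**: updating the pure tensor at `b` does not change `rest (cmPlacesEquiv L b)`. -/
theorem rest_update (b : InfinitePlace L)
    (m : ∀ b : InfinitePlace L, ((printPlaces (InfinitePlace L) (kindOf L dV hdV dW hdW ι₁ datum)
      (lamOf L dV hdV dW hdW ι₁ datum) (lamOf_ne_zero L dV hdV dW hdW ι₁ datum)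
      (pinnedVacs (kindOf L dV hdV dW hdW ι₁ datum) m₁ m₂)).loc b).M)
    (y : ((printPlaces (InfinitePlace L) (kindOf L dV hdV dW hdW ι₁ datum)
      (lamOf L dV hdV dW hdW ι₁ datum) (lamOf_ne_zero L dV hdV dW hdW ι₁ datum)
      (pinnedVacs (kindOf L dV hdV dW hdW ι₁ datum) m₁ m₂)).loc b).M) :
    rest L dV hdV dW hdW ι₁ datum m₁ m₂ (cmPlacesEquiv L b) (Function.update m b y) =
      rest L dV hdV dW hdW ι₁ datum m₁ m₂ (cmPlacesEquiv L b) m := by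
  unfold rest placePoly
  congr 1
  refine Finset.prod_congr rfl fun w' _ => ?_
  have hne : (cmPlacesEquiv L).symm w'.1 ≠ b := by
    intro h
    apply w'.2
    have h' := congrArg (cmPlacesEquiv L) h
    rwa [Equiv.apply_symm_apply] at h'
  rw [Function.update_of_ne hne]

/-- **the inserted pure tensor in the block frame of the place `b`** (kit #12 at the frame of record):
`ins f (⊗ₜ m) = E(F_v⁻¹(binvPi (rename (cmIdx v) (emb_b (m b))) ⊠ rest_v m) ⊗ f)`, `v = cmPlacesEquiv L b`. -/
theorem ins_tprod_eq_block (f : FinSB ↥(maximalRealSubfield L) (Fin 6)) (b : InfinitePlace L)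
    (m : ∀ b : InfinitePlace L, ((printPlaces (InfinitePlace L) (kindOf L dV hdV dW hdW ι₁ datum)
      (lamOf L dV hdV dW hdW ι₁ datum) (lamOf_ne_zero L dV hdV dW hdW ι₁ datum)
      (pinnedVacs (kindOf L dV hdV dW hdW ι₁ datum) m₁ m₂)).loc b).M) :
    ins L dV hdV hdV0 dW hdW hdW0 ι₁ datum m₁ m₂ f (PiTensorProduct.tprod ℂ m) =
      piSchwartzBruhatEquiv ↥(maximalRealSubfield L) (Fin 6)
        ((cmBlockFrameAt L finProdFinEquiv dV hdV hdV0 dW hdW hdW0 ι₁ (cmPlacesEquiv L b)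
            (Equiv.refl _) (Equiv.refl _) (Equiv.refl _) (Equiv.refl _)).symm
          (tensorPi (binvPi (rename (cmIdx L dV hdV dW hdW ι₁ (cmPlacesEquiv L b))
              (embOf L dV hdV dW hdW ι₁ datum m₁ m₂ b (m b))))
            (rest L dV hdV dW hdW ι₁ datum m₁ m₂ (cmPlacesEquiv L b) m)) ⊗ₜ f) := by
  rw [ins_tprod, follandFock_prod_atPlace_eq_symm_tensorPi L finProdFinEquiv dV hdV hdV0 dW hdW hdW0 ι₁ (cmPlacesEquiv L b)
    (Equiv.refl _) (Equiv.refl _) (Equiv.refl _) (Equiv.refl _), placePoly_apply]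
  rfl

/-- LEMMA A in the currency of the census data (`embOf`, `kindOf`, `lamOf`). -/
theorem hypOpWGen_binvPi_embOf (b : InfinitePlace L) (u : HypIdx (kindOf L dV hdV dW hdW ι₁ datum b))
    (x : ((printPlaces (InfinitePlace L) (kindOf L dV hdV dW hdW ι₁ datum)
      (lamOf L dV hdV dW hdW ι₁ datum) (lamOf_ne_zero L dV hdV dW hdW ι₁ datum)
      (pinnedVacs (kindOf L dV hdV dW hdW ι₁ datum) m₁ m₂)).loc b).M) :
    hypOpWGen (PosIdx (cmXV L dV hdV ι₁ (cmPlacesEquiv L b))) (NegIdx (cmXV L dV hdV ι₁ (cmPlacesEquiv L b)))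
        ((datum b).r₀ u) ((datum b).s₀ u)
        (binvPi (rename (cmIdx L dV hdV dW hdW ι₁ (cmPlacesEquiv L b)) (embOf L dV hdV dW hdW ι₁ datum m₁ m₂ b x))) =
      binvPi (rename (cmIdx L dV hdV dW hdW ι₁ (cmPlacesEquiv L b)) (embOf L dV hdV dW hdW ι₁ datum m₁ m₂ b
        (hypLoc (lamOf L dV hdV dW hdW ι₁ datum b) (lamOf_ne_zero L dV hdV dW hdW ι₁ datum b)
          (pinnedVacs (kindOf L dV hdV dW hdW ι₁ datum) m₁ m₂ b) (kindOf L dV hdV dW hdW ι₁ datum b) u x))) :=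
  (datum b).hypOpWGen_binvPi_emb _ u x

/-- **the slot operator on pure tensors**: `H^{(b)} (⊗ₜ m) = ⊗ₜ (update m b (hypLoc_b u (m b)))` (pv `slot_tprod`). -/
theorem hypX_tprod (b : InfinitePlace L) (u : HypIdx (kindOf L dV hdV dW hdW ι₁ datum b))
    (m : ∀ b : InfinitePlace L, ((printPlaces (InfinitePlace L) (kindOf L dV hdV dW hdW ι₁ datum)
      (lamOf L dV hdV dW hdW ι₁ datum) (lamOf_ne_zero L dV hdV dW hdW ι₁ datum)
      (pinnedVacs (kindOf L dV hdV dW hdW ι₁ datum) m₁ m₂)).loc b).M) :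
    hypX (InfinitePlace L) (kindOf L dV hdV dW hdW ι₁ datum) (lamOf L dV hdV dW hdW ι₁ datum)
        (lamOf_ne_zero L dV hdV dW hdW ι₁ datum) (pinnedVacs (kindOf L dV hdV dW hdW ι₁ datum) m₁ m₂) ⟨b, u⟩
        (PiTensorProduct.tprod ℂ m) =
      PiTensorProduct.tprod ℂ (Function.update m b
        (hypLoc (lamOf L dV hdV dW hdW ι₁ datum b) (lamOf_ne_zero L dV hdV dW hdW ι₁ datum b)
          (pinnedVacs (kindOf L dV hdV dW hdW ι₁ datum) m₁ m₂ b) (kindOf L dV hdV dW hdW ι₁ datum b) u (m b))) :=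
  slot_tprod b _ m

/-- **the inserted slot image in the block frame of `b`**: `ins f (H^{(b)} ⊗ₜ m) = E(F_v⁻¹((hypOpWGen (binvPi …)) ⊠ rest_v m) ⊗ f)`
— LEMMA A + `rest_update`; the shape of the limit in `SmoothW.tendsto_omgW_boostCurveW_sub_div`. -/
theorem ins_hypX_tprod_eq_block (f : FinSB ↥(maximalRealSubfield L) (Fin 6)) (b : InfinitePlace L)
    (u : HypIdx (kindOf L dV hdV dW hdW ι₁ datum b))
    (m : ∀ b : InfinitePlace L, ((printPlaces (InfinitePlace L) (kindOf L dV hdV dW hdW ι₁ datum)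
      (lamOf L dV hdV dW hdW ι₁ datum) (lamOf_ne_zero L dV hdV dW hdW ι₁ datum)
      (pinnedVacs (kindOf L dV hdV dW hdW ι₁ datum) m₁ m₂)).loc b).M) :
    ins L dV hdV hdV0 dW hdW hdW0 ι₁ datum m₁ m₂ f
        (hypX (InfinitePlace L) (kindOf L dV hdV dW hdW ι₁ datum) (lamOf L dV hdV dW hdW ι₁ datum)
          (lamOf_ne_zero L dV hdV dW hdW ι₁ datum) (pinnedVacs (kindOf L dV hdV dW hdW ι₁ datum) m₁ m₂) ⟨b, u⟩
          (PiTensorProduct.tprod ℂ m)) =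
      piSchwartzBruhatEquiv ↥(maximalRealSubfield L) (Fin 6)
        ((cmBlockFrameAt L finProdFinEquiv dV hdV hdV0 dW hdW hdW0 ι₁ (cmPlacesEquiv L b)
            (Equiv.refl _) (Equiv.refl _) (Equiv.refl _) (Equiv.refl _)).symm
          (tensorPi
            (hypOpWGen (PosIdx (cmXV L dV hdV ι₁ (cmPlacesEquiv L b))) (NegIdx (cmXV L dV hdV ι₁ (cmPlacesEquiv L b)))
              ((datum b).r₀ u) ((datum b).s₀ u)
              (binvPi (rename (cmIdx L dV hdV dW hdW ι₁ (cmPlacesEquiv L b)) (embOf L dV hdV dW hdW ι₁ datum m₁ m₂ b (m b)))))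
            (rest L dV hdV dW hdW ι₁ datum m₁ m₂ (cmPlacesEquiv L b) m)) ⊗ₜ f) := by
  rw [hypX_tprod]
  refine (ins_tprod_eq_block L dV hdV hdV0 dW hdW hdW0 ι₁ datum m₁ m₂ f b _).trans ?_
  rw [rest_update, Function.update_self, hypOpWGen_binvPi_embOf]

end Global

end HodgeCM.Model.HypCensus

end
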